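import Summits.QuantumAdvantage.QuantumAdvantage.Theorems.LinnikCubicClassGroupsDegreeOnePrimesEscapeKappaFreeAllFields
import Summits.QuantumAdvantage.QuantumAdvantage.Theorems.LinnikCubicClassGroupsDegreeOnePrimesEscapeClassPNTTheta
import Literature.NumberTheory.LFunctions.StarkNoQuadraticSubfieldProofs
import HarnessLib

/-!
# The smoothed prime ideal sum in the Linnik range with an EXPONENTIALLY DECAYING error term, for every
# number field without quadratic subfield (the error-term shape of Thorner–Zaman 2019, Thm 1.4) — smoothed part

Topic `Summits/QuantumAdvantage/QuantumAdvantage/Theorems`, cell B2b-1 (linnik-cubic), PART A (maintenance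
seat, generation 15); helper for the crux `DegreeOnePrimesEscape` (stmt-QuantumAdvantage-11543) of route
`LinnikCubicClassGroups`.  HONEST FRAMING: the value of this file is a THEOREM (kernel-checked, GRH-free,
Siegel-free) — NOT summit progress (the route rests on the hypothesis-type target `PureCubicClassNumberHard`).

The tree's prime ideal theorems in the Linnik range `x ≥ Q^{C}` (`Q = |d_K|·n_K^{n_K}`) are stated with a
FIXED relative error `ε` and a threshold `C(ε)` (`lowerPIT_allFields`, `classPNT_eps_of_odd`, …).  Here the
error is made to DECAY inside the range, in the shape of [ThornerZaman2019, Thm 1.4]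
(`e^{−c log x / log Q} + e^{−√(c log x)}`), for every number field `K` of degree `n > 1` WITHOUT QUADRATIC
SUBFIELD (in particular every field of odd degree, every cubic field):

* `allZerosGood_of_noQuadraticSubfield` — Landau–Page (`exists_exceptionalZero_const`: a zero of `ζ₁_K`
  outside the classical region is real) + Stark 1974 Thm 3 (`Stark1974_dedekindZeta_ne_zero_of_noQuadraticSubfield_holds`:
  no real zero in `[1 − 1/(4·n!·log|d_K|), 1)`) put EVERY non-trivial zero of `ζ₁_K` inside
  `β ≤ 1 − c/(a log Q + log(|γ| + 4))` with `c = min(c₀, 1/8, 1/(4·n!))`;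
* `norm_coefFordK_one_tzTest_sub_le` — the smoothed explicit formula for `ζ_K` read TWO-SIDEDLY:
  `‖K_1(g) − F(−1)‖ ≤ B + m₀(log x + ε) + ‖J₁(0)‖` whenever the finite partial sums of `m(ρ)‖F(−ρ)‖` over the
  non-trivial zeros are `≤ B`;
* `abs_re_coefFordK_one_sub_le_of_noQuadraticSubfield` — with the log-free density bound for `ζ₁_K` in
  `Q`-form as hypothesis: `|Re K_1(g_x) − x| ≤ A x (e^{−c log x/log Q} + e^{−√(c log x)}) + A x^{1−ν}`,
  `g_x = tzTest (log x) x^{−ν}`, `x ≥ Q^{a₁}`;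
The unsmoothed, unconditional form `|θ_K(x) − x| ≤ A·x·(e^{−c log x / log Q} + e^{−√(c log x)} + x^{−ν})`
is in the sequel `…ThetaDecay.lean`; it is the input of the uniform Mertens theorem in the Linnik range.

## References

* J. Thorner, A. Zaman, *A unified and improved Chebotarev density theorem*, Algebra Number Theory 13
  (2019), Thm 1.4 (error term `e^{−c₃ log x/log(D_K Q n^n)} + e^{−(c₄ log x)^{1/2}/n}`) and Lemmas 4.5–4.6.
  [ThornerZaman2019]
* H. M. Stark, *Some effective cases of the Brauer–Siegel theorem*, Invent. Math. 23 (1974), Thm 3. [Stark1974]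
-/

noncomputable section

open Complex Real MeasureTheory Set Filter Topology
open scoped NumberField nonZeroDivisors
open Literature.NumberTheory.LFunctions Literature.NumberTheory.LFunctions.NumberField
  Literature.NumberTheory.LFunctions.EntireEF Literature.NumberTheory.LFunctions.TZWeight

namespace Summit.QuantumAdvantage.QuantumAdvantage.Theorems.DegreeOnePrimesEscape

/-! ### All non-trivial zeros of `ζ₁_K` lie in the classical region when `K` has no quadratic subfield -/

/-- **No exceptional zero for fields without quadratic subfield.** Let `c₀` be the Landau–Page constant of
`exists_exceptionalZero_const n` and `0 < c ≤ min(c₀, 1/(4·n!))`, `a ≥ 1`.  For every number field `K` of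
degree `n > 1` without quadratic subfield, every non-trivial zero `ρ` (`0 < Re ρ < 1`) of `ζ₁_K` satisfies
`Re ρ ≤ 1 − c/(a log Q + log(|Im ρ| + 4))` (`Q = condQn K`): a zero outside is real by Landau–Page, hence a
real zero of `ζ_K` in `(0,1)`, and Stark's theorem excludes `[1 − 1/(4·n!·log|d_K|), 1)`. -/
theorem allZerosGood_of_noQuadraticSubfield (n : ℕ) (hn : 1 < n) {c₀ : ℝ}
    (hpack : ∀ (K : Type) [Field K] [NumberField K], Module.finrank ℚ K = n →
      let Z : (ClassGroup (𝓞 K) →* ℂˣ) → ℂ → Prop := fun χ ρ ↦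
        ((χ = 1 → dedekindZeta₁ K ρ = 0) ∧ (χ ≠ 1 → classGroupLFunction₀ K χ ρ = 0)) ∧
          1 - c₀ / (Real.log ((NumberField.discr K).natAbs : ℝ) + Real.log (|ρ.im| + 4)) < ρ.re
      (∀ χ ρ, Z χ ρ → ρ.im = 0 ∧ χ * χ = 1) ∧
      (∀ χ₁ χ₂ ρ₁ ρ₂, Z χ₁ ρ₁ → Z χ₂ ρ₂ → χ₁ = χ₂ ∧ ρ₁ = ρ₂) ∧
      (∀ χ ρ, Z χ ρ → (χ = 1 → analyticOrderAt (dedekindZeta₁ K) ρ = 1) ∧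
        (χ ≠ 1 → analyticOrderAt (classGroupLFunction₀ K χ) ρ = 1)))
    {c a : ℝ} (hc : 0 < c) (hcc₀ : c ≤ c₀) (hcn : c ≤ 1 / (4 * (n.factorial : ℝ))) (ha : 1 ≤ a)
    (K : Type) [Field K] [NumberField K] (hKn : Module.finrank ℚ K = n)
    (hnq : ∀ F : IntermediateField ℚ K, Module.finrank ℚ F ≠ 2)
    {ρ : ℂ} (h0 : dedekindZeta₁ K ρ = 0) (hre0 : 0 < ρ.re) (hre1 : ρ.re < 1) :
    ρ.re ≤ 1 - c / (a * Real.log (ThornerZaman.condQn K) + Real.log (|ρ.im| + 4)) := by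
  have hK : 1 < Module.finrank ℚ K := by rw [hKn]; exact hn
  by_contra hng
  -- Landau–Page: the zero is real
  obtain ⟨hLPreal, -, -⟩ := hpack K hKn
  have hregion : (((1 : ClassGroup (𝓞 K) →* ℂˣ) = 1 → dedekindZeta₁ K ρ = 0) ∧
        ((1 : ClassGroup (𝓞 K) →* ℂˣ) ≠ 1 → classGroupLFunction₀ K 1 ρ = 0)) ∧
      1 - c₀ / (Real.log ((NumberField.discr K).natAbs : ℝ) + Real.log (|ρ.im| + 4)) < ρ.re :=
    ⟨⟨fun _ ↦ h0, fun h ↦ absurd rfl h⟩, lpRegion_of_not_good K hK hc hcc₀ ha hng⟩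
  have him : ρ.im = 0 := (hLPreal 1 ρ hregion).1
  -- so `ρ = β` is a real zero of `ζ_K` in `(0, 1)`
  set β : ℝ := ρ.re with hβ
  have hρeq : ρ = ((β : ℝ) : ℂ) := by apply Complex.ext <;> simp [hβ, him]
  have hζ : dedekindZetaCont K β = 0 := by
    have hne : ((β : ℝ) : ℂ) ≠ 1 := by
      intro h; apply hre1.ne; exact_mod_cast h
    have h1 := dedekindZeta₁_apply_of_ne_one (K := K) hne
    have h0' : dedekindZeta₁ K ((β : ℝ) : ℂ) = 0 := by rw [← hρeq]; exact h0
    rw [h0'] at h1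
    rcases mul_eq_zero.1 h1.symm with h2 | h2
    · exact absurd (sub_eq_zero.1 h2) hne
    · exact h2
  -- Stark: no zero in `[1 − 1/(4 n! log|d_K|), 1)`; so `β < 1 − 1/(4 n! log|d_K|)`
  have hStark := Stark1974_dedekindZeta_ne_zero_of_noQuadraticSubfield_holds K hnq β
  have hβlt : β < 1 - 1 / (4 * ((Module.finrank ℚ K).factorial : ℝ) * Real.log ((NumberField.discr K).natAbs : ℝ)) := by
    by_contra hle
    exact hStark (not_lt.1 hle) hre1 hζ
  rw [hKn] at hβlt
  -- compare the two regions
  have hQ12 : (12 : ℝ) ≤ ThornerZaman.condQn K := ThornerZaman.twelve_le_condQn (K := K) hK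
  have hd0 : (0 : ℝ) < ((NumberField.discr K).natAbs : ℝ) := by
    exact_mod_cast Nat.pos_of_ne_zero (Int.natAbs_ne_zero.2 (NumberField.discr_ne_zero K))
  have hlogd0 : 0 ≤ Real.log ((NumberField.discr K).natAbs : ℝ) := Real.log_natCast_nonneg _
  have hlogdQ : Real.log ((NumberField.discr K).natAbs : ℝ) ≤ a * Real.log (ThornerZaman.condQn K) := by
    have h1 := Real.log_le_log hd0 (natAbs_discr_le_condQn K)
    have h2 : 0 ≤ Real.log (ThornerZaman.condQn K) := Real.log_nonneg (by linarith)
    nlinarith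
  have hlog4 : 0 < Real.log (|ρ.im| + 4) := Real.log_pos (by linarith [abs_nonneg ρ.im])
  have hfac : (0 : ℝ) < (n.factorial : ℝ) := by exact_mod_cast Nat.factorial_pos n
  set D : ℝ := a * Real.log (ThornerZaman.condQn K) + Real.log (|ρ.im| + 4) with hD
  have hD0 : 0 < D := by rw [hD]; linarith
  rw [not_le] at hng
  -- `|d_K| ≥ 3` (Minkowski), so `log|d_K| > 0` and `c / D ≤ 1/(4 n! log|d_K|)`
  have hlogpos : 0 < Real.log ((NumberField.discr K).natAbs : ℝ) := by
    have h2 := NumberField.abs_discr_gt_two hK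
    have h3 : (2 : ℝ) < ((NumberField.discr K).natAbs : ℝ) := by
      have : (2 : ℤ) < ((NumberField.discr K).natAbs : ℤ) := by rwa [Int.natCast_natAbs]
      exact_mod_cast this
    exact Real.log_pos (by linarith)
  have hden : 0 < 4 * (n.factorial : ℝ) * Real.log ((NumberField.discr K).natAbs : ℝ) := by positivity
  have key : c / D ≤ 1 / (4 * (n.factorial : ℝ) * Real.log ((NumberField.discr K).natAbs : ℝ)) := by
    rw [div_le_div_iff₀ hD0 hden, one_mul]
    calc c * (4 * (n.factorial : ℝ) * Real.log ((NumberField.discr K).natAbs : ℝ))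
        ≤ 1 / (4 * (n.factorial : ℝ)) * (4 * (n.factorial : ℝ) * Real.log ((NumberField.discr K).natAbs : ℝ)) :=
          mul_le_mul_of_nonneg_right hcn hden.le
      _ = Real.log ((NumberField.discr K).natAbs : ℝ) := by field_simp
      _ ≤ D := by rw [hD]; linarith
  linarith

/-! ### The smoothed explicit formula, two-sided -/

variable {K : Type} [Field K] [NumberField K]

set_option maxHeartbeats 800000 in
/-- **The explicit formula for `ζ_K` read two-sidedly**: for `x > 1`, `0 < ε < (log x)/2` and a bound `B`
for the finite partial sums of `m(ρ)‖F(−ρ)‖` over the non-trivial zeros of `ζ₁_K`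
(`g = tzTest (log x) ε`, `F` its Laplace transform, `K_1(g) = Σ Λ_K(𝔞) g(log N𝔞)`):
`‖K_1(g) − F(−1)‖ ≤ B + m₀ (log x + ε) + ‖J₁(0)‖`. [cite: ThornerZaman2019, §5 (explicit formula)] -/
theorem norm_coefFordK_one_tzTest_sub_le {x ε : ℝ} (hx : 1 < x) (hε : 0 < ε) (hεL : ε < Real.log x / 2)
    {B : ℝ}
    (hB : ∀ u : Finset ℂ, (∀ ρ ∈ u, dedekindZeta₁ K ρ = 0 ∧ 0 < ρ.re ∧ ρ.re < 1) →
      ∑ ρ ∈ u, (analyticOrderNatAt (dedekindZeta₁ K) ρ : ℝ) * ‖fordLaplace (tzTest (Real.log x) ε) (-ρ)‖ ≤ B) :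
    ‖coefFordK (cgCoef (1 : ClassGroup (𝓞 K) →* ℂˣ)) (tzTest (Real.log x) ε) 0 -
        fordLaplace (tzTest (Real.log x) ε) (-1)‖ ≤
      B + (analyticOrderNatAt (dedekindZeta₁ K) 0 : ℝ) * (Real.log x + ε) +
        ‖dzEFRemainder K (tzTest (Real.log x) ε) 0‖ := by
  classical
  set Lx := Real.log x with hLx
  have hL : 0 < Lx := Real.log_pos hx
  have hadm := isSmoothedEFTest_tzTest hL hε
  have hg0 : tzTest Lx ε 0 = 0 := tzTest_zero hL hε hεL.le
  have hsz : ∀ ρ : ℂ, dedekindZeta₁ K ρ = 0 → 0 < ρ.re → ρ.re < 1 → ρ ≠ 0 := by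
    intro ρ _ h1 _ h; rw [h] at h1; simp at h1
  have hexpl := coefFordK_one_eq_explicit (K := K) hadm hg0 (s := 0) (by norm_num) (by norm_num) hsz
  -- the zero sum
  set a : nontrivialZeros (dedekindZeta₁ K) → ℂ := fun ρ ↦
    (analyticOrderNatAt (dedekindZeta₁ K) (ρ : ℂ) : ℂ) * fordLaplace₀ (tzTest Lx ε) (0 - ρ) with ha
  have hsum : Summable (fun ρ ↦ ‖a ρ‖) :=
    summable_norm_dzZeroTerm (K := K) hadm (s := 0) (by norm_num) hsz
  have ha_eq : ∀ ρ : nontrivialZeros (dedekindZeta₁ K),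
      ‖a ρ‖ = (analyticOrderNatAt (dedekindZeta₁ K) (ρ : ℂ) : ℝ) * ‖fordLaplace (tzTest Lx ε) (-(ρ : ℂ))‖ := by
    intro ρ
    rw [ha]; dsimp only
    rw [zero_sub, fordLaplace₀_eq_fordLaplace hg0, norm_mul, Complex.norm_natCast]
  have htsumB : ∑' ρ, ‖a ρ‖ ≤ B := by
    refine hsum.tsum_le_of_sum_le fun s ↦ ?_
    have hinj : Set.InjOn (Subtype.val : nontrivialZeros (dedekindZeta₁ K) → ℂ) ↑s :=
      fun a _ b _ h ↦ Subtype.ext h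
    have hBs := hB (s.image Subtype.val) (fun ρ hρ ↦ ?_)
    · refine le_trans (le_of_eq ?_) hBs
      rw [Finset.sum_image hinj]
      exact Finset.sum_congr rfl fun ρ _ ↦ ha_eq ρ
    · obtain ⟨ρ', _, rfl⟩ := Finset.mem_image.1 hρ
      exact ρ'.2
  have hZ : ‖∑' ρ, a ρ‖ ≤ B := (norm_tsum_le_tsum_norm hsum).trans htsumB
  -- `m₀ F(0)`
  have hF0 : ‖fordLaplace₀ (tzTest Lx ε) 0‖ ≤ Lx + ε := by
    rw [fordLaplace₀_eq_fordLaplace hg0]; exact norm_fordLaplace_tzTest_zero_le hL hε hεL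
  have h2 : ‖(analyticOrderNatAt (dedekindZeta₁ K) 0 : ℂ) * fordLaplace₀ (tzTest Lx ε) 0‖ ≤
      (analyticOrderNatAt (dedekindZeta₁ K) 0 : ℝ) * (Lx + ε) := by
    rw [norm_mul, Complex.norm_natCast]
    exact mul_le_mul_of_nonneg_left hF0 (Nat.cast_nonneg _)
  -- the main term
  have hmainF : fordLaplace₀ (tzTest Lx ε) (0 - 1) = fordLaplace (tzTest Lx ε) (-(1 : ℂ)) := by
    rw [zero_sub, fordLaplace₀_eq_fordLaplace hg0]
  have hK : coefFordK (cgCoef (1 : ClassGroup (𝓞 K) →* ℂˣ)) (tzTest Lx ε) 0 - fordLaplace (tzTest Lx ε) (-1) =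
      -(∑' ρ, a ρ) - (analyticOrderNatAt (dedekindZeta₁ K) 0 : ℂ) * fordLaplace₀ (tzTest Lx ε) 0 +
        dzEFRemainder K (tzTest Lx ε) 0 := by
    rw [hexpl, hmainF]; ring
  rw [hK]
  calc ‖-(∑' ρ, a ρ) - (analyticOrderNatAt (dedekindZeta₁ K) 0 : ℂ) * fordLaplace₀ (tzTest Lx ε) 0 +
        dzEFRemainder K (tzTest Lx ε) 0‖
      ≤ ‖-(∑' ρ, a ρ) - (analyticOrderNatAt (dedekindZeta₁ K) 0 : ℂ) * fordLaplace₀ (tzTest Lx ε) 0‖ +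
        ‖dzEFRemainder K (tzTest Lx ε) 0‖ := norm_add_le _ _
    _ ≤ ‖-(∑' ρ, a ρ)‖ + ‖(analyticOrderNatAt (dedekindZeta₁ K) 0 : ℂ) * fordLaplace₀ (tzTest Lx ε) 0‖ +
        ‖dzEFRemainder K (tzTest Lx ε) 0‖ := by gcongr; exact norm_sub_le _ _
    _ ≤ B + (analyticOrderNatAt (dedekindZeta₁ K) 0 : ℝ) * (Lx + ε) + ‖dzEFRemainder K (tzTest Lx ε) 0‖ := by
        rw [norm_neg]; gcongr

/-! ### The smoothed prime ideal sum with a decaying error -/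

set_option maxHeartbeats 1600000 in
/-- **The smoothed prime ideal sum of a field without quadratic subfield, with an exponentially decaying
error** (density for `ζ₁_K` in `Q`-form as hypothesis; general degree `n > 1`): there are `ν ∈ (0, 1/64]`,
`a₁ ≥ 1`, `A, c > 0` depending only on `n, b, D, a` such that for every `K` of degree `n` without quadratic
subfield obeying the density bound and every `x ≥ Q^{a₁}` (`g_x = tzTest (log x) x^{−ν}`):
`|Re K_1(g_x) − x| ≤ A x (e^{−c log x / log Q} + e^{−√(c log x)}) + A x^{1−ν}`. -/
theorem abs_re_coefFordK_one_sub_le_of_noQuadraticSubfield (n : ℕ) (hn : 1 < n) {b D a : ℝ}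
    (hb : 0 < b) (hD : 0 < D) (ha : 1 ≤ a) :
    ∃ ν a₁ A c : ℝ, 0 < ν ∧ ν ≤ 1 / 64 ∧ 1 ≤ a₁ ∧ 0 < A ∧ 0 < c ∧
    ∀ (K : Type) [Field K] [NumberField K], Module.finrank ℚ K = n →
      (∀ F : IntermediateField ℚ K, Module.finrank ℚ F ≠ 2) →
      (∀ T : ℝ, 1 ≤ T → ∀ u : Finset ℂ,
        (∀ ρ ∈ u, dedekindZeta₁ K ρ = 0 ∧ 1 / 4 ≤ ρ.re ∧ ρ.re < 1 ∧ |ρ.im| ≤ T) →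
        ∀ α : ℝ, α ≤ 1 →
          ∑ ρ ∈ u with α ≤ ρ.re, (analyticOrderNatAt (dedekindZeta₁ K) ρ : ℝ) ≤
            D * Real.exp (b * (a * Real.log (ThornerZaman.condQn K) + Real.log (T + 4))) ^ (1 - α)) →
      ∀ x : ℝ, ThornerZaman.condQn K ^ a₁ ≤ x →
        |(coefFordK (cgCoef (1 : ClassGroup (𝓞 K) →* ℂˣ)) (tzTest (Real.log x) (x ^ (-ν))) 0).re - x| ≤
          A * x * (Real.exp (-(c * Real.log x / Real.log (ThornerZaman.condQn K))) +
              Real.exp (-Real.sqrt (c * Real.log x))) + A * x ^ (1 - ν) := by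
  obtain ⟨ν, a₀, A₀, hν0, hν64, ha₀1, hA₀, hZ⟩ := zeroSum_dedekindZeta₁_zfr_le n hn hb hD ha
  obtain ⟨c₀, hc₀, hpack⟩ := exists_exceptionalZero_const n
  obtain ⟨Al, hAl0, hAl⟩ := exists_norm_logDeriv_classGroupLFunction_left_le
  obtain ⟨M, hM1, hM⟩ := TZWeight.exists_smoothTransition_deriv_bound
  have hlC := leftLineConst_nonneg
  have hfac : (0 : ℝ) < (n.factorial : ℝ) := by exact_mod_cast Nat.factorial_pos n
  set c : ℝ := min (min c₀ (1 / 8)) (1 / (4 * (n.factorial : ℝ))) with hcdef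
  have hc : 0 < c := lt_min (lt_min hc₀ (by norm_num)) (by positivity)
  have hcc₀ : c ≤ c₀ := (min_le_left _ _).trans (min_le_left _ _)
  have hcn : c ≤ 1 / (4 * (n.factorial : ℝ)) := min_le_right _ _
  set CJ : ℝ := 8 * leftLineConst * Al * ((n : ℝ) + 1) * M with hCJ
  have hM0 : 0 ≤ M := by linarith
  have hCJ0 : 0 ≤ CJ := by positivity
  set a₁ : ℝ := max a₀ 32 with ha₁
  set A : ℝ := A₀ + CJ + 1156 with hA
  have hA0 : 0 < A := by positivity
  set c' : ℝ := c / (4 * a) with hc'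
  have hc'0 : 0 < c' := by positivity
  refine ⟨ν, a₁, A, c', hν0, hν64, le_max_of_le_right (by norm_num), hA0, hc'0,
    fun K _ _ hKn hnq hdens x hx ↦ ?_⟩
  -- sizes
  have hK : 1 < Module.finrank ℚ K := by rw [hKn]; exact hn
  set Q : ℝ := ThornerZaman.condQn K with hQ
  have hQ12 : (12 : ℝ) ≤ Q := ThornerZaman.twelve_le_condQn (K := K) hK
  have hQ1 : (1 : ℝ) < Q := by linarith
  have hQ0 : (0 : ℝ) < Q := by linarith
  have hlog12 : (2 : ℝ) ≤ Real.log 12 := by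
    rw [Real.le_log_iff_exp_le (by norm_num)]
    have := Real.exp_one_lt_d9
    have h : Real.exp 2 = Real.exp 1 * Real.exp 1 := by rw [← Real.exp_add]; norm_num
    rw [h]; nlinarith [Real.exp_pos (1:ℝ)]
  have hlogQ : 2 ≤ Real.log Q := hlog12.trans (Real.log_le_log (by norm_num) hQ12)
  have hlogQ0 : 0 < Real.log Q := by linarith
  have ha₁a₀ : a₀ ≤ a₁ := le_max_left _ _
  have ha₁32 : (32 : ℝ) ≤ a₁ := le_max_right _ _
  have ha₁1 : (1 : ℝ) ≤ a₁ := by linarith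
  have hxa₀ : Q ^ a₀ ≤ x := le_trans (Real.rpow_le_rpow_of_exponent_le hQ1.le ha₁a₀) hx
  have hxQ : Q ≤ x := by
    have : Q ^ (1 : ℝ) ≤ Q ^ a₁ := Real.rpow_le_rpow_of_exponent_le hQ1.le ha₁1
    rw [Real.rpow_one] at this; linarith
  have hx1 : 1 < x := by linarith
  have hx0 : 0 < x := by linarith
  set L : ℝ := Real.log x with hL
  have hLQ : a₁ * Real.log Q ≤ L := by
    have := Real.log_le_log (by positivity) hx
    rwa [Real.log_rpow hQ0] at this
  have hL64 : 64 ≤ L := by nlinarith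
  have hL0 : 0 < L := by linarith
  have hexpL : Real.exp L = x := by rw [hL, Real.exp_log hx0]
  have hQexp : Q ≤ Real.exp (L / 8) := by
    refine le_exp_of_log_le hQ0 ?_
    rw [le_div_iff₀ (by norm_num)]; nlinarith
  -- `ε = x^{−ν}`
  set ε : ℝ := x ^ (-ν) with hε
  have hε0 : 0 < ε := Real.rpow_pos_of_pos hx0 _
  have hε1 : ε ≤ 1 := Real.rpow_le_one_of_one_le_of_nonpos hx1.le (by linarith)
  have hεL : ε < L / 2 := by linarith
  have hεexp : ε = Real.exp (-(ν * L)) := by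
    rw [hε, Real.rpow_def_of_pos hx0, ← hL]; ring_nf
  have hxε : x ^ (1 - ν) = x * ε := by
    rw [hε, sub_eq_add_neg, Real.rpow_add hx0, Real.rpow_one]
  -- every zero is good, so the zero-sum bound holds for all finite sets of non-trivial zeros
  have hgood : ∀ ρ : ℂ, dedekindZeta₁ K ρ = 0 → 0 < ρ.re → ρ.re < 1 →
      ρ.re ≤ 1 - c / (a * Real.log Q + Real.log (|ρ.im| + 4)) :=
    fun ρ h0 h1 h2 ↦ allZerosGood_of_noQuadraticSubfield n hn hpack hc hcc₀ hcn ha K hKn hnq h0 h1 h2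
  set Bz : ℝ := A₀ * x * (Real.exp (-(c * Real.log x / (4 * a * Real.log Q))) +
      Real.exp (-Real.sqrt (c * Real.log x / 4))) + A₀ * x ^ (1 - ν) with hBz
  have hB : ∀ u : Finset ℂ, (∀ ρ ∈ u, dedekindZeta₁ K ρ = 0 ∧ 0 < ρ.re ∧ ρ.re < 1) →
      ∑ ρ ∈ u, (analyticOrderNatAt (dedekindZeta₁ K) ρ : ℝ) * ‖fordLaplace (tzTest (Real.log x) ε) (-ρ)‖ ≤ Bz := by
    intro u hu
    have h := hZ c hc K hKn hdens x hxa₀ ε le_rfl hε1 u hu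
    rwa [Finset.filter_true_of_mem
      (fun ρ hρ ↦ hgood ρ (hu ρ hρ).1 (hu ρ hρ).2.1 (hu ρ hρ).2.2)] at h
  have hEF := norm_coefFordK_one_tzTest_sub_le (K := K) hx1 hε0 hεL hB
  -- the main term and the secondary terms
  have hmain := abs_re_fordLaplace_tzTest_neg_one_sub_le hx1 hε0 hε1 hεL
  have hiii : (analyticOrderNatAt (dedekindZeta₁ K) 0 : ℝ) * (L + ε) ≤ 1152 * Real.exp (L / 4) :=
    trivialZero_term_le_one K hK (by linarith) hε0.le hε1 hQexp
  have hiv : ‖dzEFRemainder K (tzTest L ε) 0‖ ≤ CJ := by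
    have hJ := leftLine_term_le_one hAl0 hAl hM K hK hL0 hε0 hεL hε1 hν64 hεexp hQexp
    rw [hKn] at hJ; rw [hCJ]; exact hJ
  -- `|Re K − x| ≤ ‖K − F(−1)‖ + |Re F(−1) − x|`
  set Kv := coefFordK (cgCoef (1 : ClassGroup (𝓞 K) →* ℂˣ)) (tzTest (Real.log x) ε) 0 with hKv
  set Fv := fordLaplace (tzTest (Real.log x) ε) (-1) with hFv
  have hsplit : |Kv.re - x| ≤ ‖Kv - Fv‖ + |Fv.re - x| := by
    have h1 : |Kv.re - Fv.re| ≤ ‖Kv - Fv‖ := by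
      rw [← Complex.sub_re]; exact Complex.abs_re_le_norm _
    have h2 : |Kv.re - x| ≤ |Kv.re - Fv.re| + |Fv.re - x| := abs_sub_le _ _ _
    linarith
  -- powers of `x`
  have h14 : Real.exp (L / 4) ≤ x ^ (1 - ν) := by
    have : Real.exp (L / 4) = x ^ ((1 : ℝ) / 4) := by
      rw [Real.rpow_def_of_pos hx0, ← hL]; ring_nf
    rw [this]
    exact Real.rpow_le_rpow_of_exponent_le hx1.le (by linarith)
  have hsqrt : Real.sqrt x ≤ x ^ (1 - ν) := by
    rw [Real.sqrt_eq_rpow]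
    exact Real.rpow_le_rpow_of_exponent_le hx1.le (by linarith)
  have hone : 1 ≤ x ^ (1 - ν) := Real.one_le_rpow hx1.le (by linarith)
  have hxν0 : 0 ≤ x ^ (1 - ν) := by positivity
  -- the exponential factors
  have hexp1 : Real.exp (-(c * Real.log x / (4 * a * Real.log Q))) = Real.exp (-(c' * Real.log x / Real.log Q)) := by
    congr 1; rw [hc']; field_simp
  have hexp2 : Real.exp (-Real.sqrt (c * Real.log x / 4)) ≤ Real.exp (-Real.sqrt (c' * Real.log x)) := by
    apply Real.exp_le_exp.2
    apply neg_le_neg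
    apply Real.sqrt_le_sqrt
    rw [hc', ← hL]
    have ha4 : 0 < 4 * a := by linarith
    rw [div_mul_eq_mul_div, div_le_div_iff₀ ha4 (by norm_num : (0:ℝ) < 4)]
    nlinarith [mul_pos hc hL0]
  have hEsum0 : 0 ≤ Real.exp (-(c' * Real.log x / Real.log Q)) + Real.exp (-Real.sqrt (c' * Real.log x)) := by
    positivity
  have hzero : A₀ * x * (Real.exp (-(c * Real.log x / (4 * a * Real.log Q))) +
      Real.exp (-Real.sqrt (c * Real.log x / 4))) ≤
      A * x * (Real.exp (-(c' * Real.log x / Real.log Q)) + Real.exp (-Real.sqrt (c' * Real.log x))) := by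
    rw [hexp1]
    have hA₀A : A₀ ≤ A := by rw [hA]; linarith
    calc A₀ * x * (Real.exp (-(c' * Real.log x / Real.log Q)) + Real.exp (-Real.sqrt (c * Real.log x / 4)))
        ≤ A₀ * x * (Real.exp (-(c' * Real.log x / Real.log Q)) + Real.exp (-Real.sqrt (c' * Real.log x))) := by
          gcongr
      _ ≤ A * x * (Real.exp (-(c' * Real.log x / Real.log Q)) + Real.exp (-Real.sqrt (c' * Real.log x))) := by
          gcongr
  -- assemble
  have hKF : ‖Kv - Fv‖ ≤ Bz + 1152 * Real.exp (L / 4) + CJ := by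
    have h1 := hEF
    rw [← hL] at h1
    linarith
  have hFx : |Fv.re - x| ≤ Real.sqrt x + 2 * ε * x := hmain
  have h2εx : 2 * ε * x = 2 * x ^ (1 - ν) := by rw [hxε]; ring
  calc |Kv.re - x| ≤ ‖Kv - Fv‖ + |Fv.re - x| := hsplit
    _ ≤ (Bz + 1152 * Real.exp (L / 4) + CJ) + (Real.sqrt x + 2 * ε * x) := by linarith
    _ = A₀ * x * (Real.exp (-(c * Real.log x / (4 * a * Real.log Q))) +
          Real.exp (-Real.sqrt (c * Real.log x / 4))) +
        (A₀ * x ^ (1 - ν) + 1152 * Real.exp (L / 4) + CJ + Real.sqrt x + 2 * x ^ (1 - ν)) := by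
          rw [hBz, h2εx]; ring
    _ ≤ A * x * (Real.exp (-(c' * Real.log x / Real.log Q)) + Real.exp (-Real.sqrt (c' * Real.log x))) +
        A * x ^ (1 - ν) := by
          have hrest : A₀ * x ^ (1 - ν) + 1152 * Real.exp (L / 4) + CJ + Real.sqrt x + 2 * x ^ (1 - ν) ≤
              A * x ^ (1 - ν) := by
            have hCJ' : CJ ≤ CJ * x ^ (1 - ν) := by nlinarith
            rw [hA]; nlinarith
          linarith

end Summit.QuantumAdvantage.QuantumAdvantage.Theorems.DegreeOnePrimesEscape

end
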